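import Summits.CriticalPhenomena.PercolationContinuityZ3.Theorems.Transplant.StatementPolynomialGrowth
import Literature.Probability.LatticeModels.LatticeGraph
import HarnessLib

/-!
# The planar skeleton of the Heisenberg Cayley graph (input Φ1 of P4-GENERAL.md §9): the `D₄` of
# generator-permuting automorphisms fixing the identity, and the abelianisation onto the square lattice

builds on p205010 (kernel theorem, internal audit signed; external expert review pending).
Lane `prim-bschramm`, seat p4.  New lemmas of the lane about the tree's `cayleyGraph` of `ℍ(ℤ)`
(`Literature/Geometry/MetricEmbeddings/HeisenbergL1.lean`: vertices `ℤ × ℤ × ℤ`,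
`(x,y,z)·(x',y',z') = (x+x', y+y', z+z'+xy')`, edges = right multiplication by `a = (1,0,0)`, `b = (0,1,0)`).

* `heisSwap (x,y,z) = (y, x, xy − z)` — the group automorphism `a ↔ b` (so `[a,b] ↦ [a,b]⁻¹`), an
  involutive GRAPH automorphism fixing `1` exchanging `a`-edges and `b`-edges (`heisSwapIso`);
* `heisFlip (x,y,z) = (−x, y, −z)` — the group automorphism `a ↦ a⁻¹, b ↦ b`, an involutive graph
  automorphism fixing `1` (`heisFlipIso`);  `⟨heisSwap, heisFlip⟩` acts on the skeleton `(x,y)` as the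
  dihedral group `D₄` of signed coordinate permutations (`heisAb_heisSwap`, `heisAb_heisFlip`) — the point
  symmetry required by Kozma–Nitzan's Lemma 8 in two dimensions;
* `heisAb (x,y,z) = ![x, y] : Site 2` — the abelianisation, a graph homomorphism onto `ℤ²`
  (`zdGraph_adj_heisAb_of_adj`: adjacent vertices have adjacent images), equivariant under left
  translations (`heisAb_heisMul`) and under the point symmetries; its fibres are the cosets of the centre
  `⟨(0,0,1)⟩`, along which `z` moves by at most `|x|` per edge (`abs_sub_le_of_adj`), the bound behind the
  cylinder cutsets of input Φ2.
[cite: CheegerKleinerNaor2011, §1.1] [cite: KozmaNitzan2024, §4 Lemma 8 (p. 16)]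
-/

noncomputable section

namespace Summit.CriticalPhenomena.PercolationContinuityZ3.Theorems

open Literature.Geometry.MetricEmbeddings Literature.Probability.LatticeModels

namespace SameP

/-! ### The two generating point symmetries -/

/-- The swap automorphism `a ↔ b` of `ℍ(ℤ)` in coordinates: `(x,y,z) ↦ (y, x, xy − z)`. [cite: CheegerKleinerNaor2011, §1.1] -/
def heisSwap (g : ℤ × ℤ × ℤ) : ℤ × ℤ × ℤ := (g.2.1, g.1, g.1 * g.2.1 - g.2.2)

/-- The flip automorphism `a ↦ a⁻¹, b ↦ b` of `ℍ(ℤ)` in coordinates: `(x,y,z) ↦ (−x, y, −z)`. [cite: CheegerKleinerNaor2011, §1.1] -/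
def heisFlip (g : ℤ × ℤ × ℤ) : ℤ × ℤ × ℤ := (-g.1, g.2.1, -g.2.2)

/-- `heisSwap` is an involution. [folklore] -/
@[simp] theorem heisSwap_heisSwap (g : ℤ × ℤ × ℤ) : heisSwap (heisSwap g) = g := by
  obtain ⟨x, y, z⟩ := g
  simp only [heisSwap, Prod.mk.injEq]
  exact ⟨trivial, trivial, by ring⟩

/-- `heisFlip` is an involution. [folklore] -/
@[simp] theorem heisFlip_heisFlip (g : ℤ × ℤ × ℤ) : heisFlip (heisFlip g) = g := by
  obtain ⟨x, y, z⟩ := g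
  simp [heisFlip]

/-- `heisSwap` is a group automorphism of `ℍ(ℤ)`. [cite: CheegerKleinerNaor2011, §1.1] -/
theorem heisSwap_heisMul (g h : ℤ × ℤ × ℤ) : heisSwap (heisMul g h) = heisMul (heisSwap g) (heisSwap h) := by
  obtain ⟨x, y, z⟩ := g
  obtain ⟨x', y', z'⟩ := h
  simp only [heisSwap, heisMul, Prod.mk.injEq]
  exact ⟨trivial, trivial, by ring⟩

/-- `heisFlip` is a group automorphism of `ℍ(ℤ)`. [cite: CheegerKleinerNaor2011, §1.1] -/
theorem heisFlip_heisMul (g h : ℤ × ℤ × ℤ) : heisFlip (heisMul g h) = heisMul (heisFlip g) (heisFlip h) := by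
  obtain ⟨x, y, z⟩ := g
  obtain ⟨x', y', z'⟩ := h
  simp only [heisFlip, heisMul, Prod.mk.injEq]
  exact ⟨by ring, trivial, by ring⟩

/-- `heisSwap` exchanges the generators: `a ↦ b`. [folklore] -/
@[simp] theorem heisSwap_genA : heisSwap genA = genB := by simp [heisSwap, genA, genB]

/-- `heisSwap` exchanges the generators: `b ↦ a`. [folklore] -/
@[simp] theorem heisSwap_genB : heisSwap genB = genA := by simp [heisSwap, genA, genB]

/-- `heisFlip` inverts `a`: `a ↦ a⁻¹ = (−1,0,0)`. [folklore] -/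
@[simp] theorem heisFlip_genA : heisFlip genA = heisInv genA := by simp [heisFlip, genA, heisInv]

/-- `heisFlip` fixes `b`. [folklore] -/
@[simp] theorem heisFlip_genB : heisFlip genB = genB := by simp [heisFlip, genB]

/-- Adjacency in the Cayley graph: `h` is `g` times a generator, or conversely. [cite: CheegerKleinerNaor2011, §1.1] -/
theorem cayleyGraph_adj_iff' (g h : ℤ × ℤ × ℤ) :
    cayleyGraph.Adj g h ↔ g ≠ h ∧ ((h = heisMul g genA ∨ h = heisMul g genB) ∨ (g = heisMul h genA ∨ g = heisMul h genB)) := by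
  rw [cayleyGraph_adj, cayleyGraph_rel_iff, cayleyGraph_rel_iff]

/-- `g · a⁻¹ · a = g`: right multiplication by `a⁻¹` reverses an `a`-edge. [folklore] -/
theorem heisMul_heisMul_heisInv_genA (g : ℤ × ℤ × ℤ) : heisMul (heisMul g (heisInv genA)) genA = g := by
  rw [heisMul_assoc, heisInv_heisMul, heisMul_zero_right]

/-- `heisSwap` preserves adjacency. [cite: CheegerKleinerNaor2011, §1.1] -/
theorem cayleyGraph_adj_heisSwap {g h : ℤ × ℤ × ℤ} (hgh : cayleyGraph.Adj g h) :
    cayleyGraph.Adj (heisSwap g) (heisSwap h) := by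
  rw [cayleyGraph_adj_iff'] at hgh ⊢
  obtain ⟨hne, hrel⟩ := hgh
  refine ⟨fun heq => hne (by simpa using congrArg heisSwap heq), ?_⟩
  rcases hrel with (rfl | rfl) | (rfl | rfl)
  · exact Or.inl (Or.inr (by rw [heisSwap_heisMul, heisSwap_genA]))
  · exact Or.inl (Or.inl (by rw [heisSwap_heisMul, heisSwap_genB]))
  · exact Or.inr (Or.inr (by rw [heisSwap_heisMul, heisSwap_genA]))
  · exact Or.inr (Or.inl (by rw [heisSwap_heisMul, heisSwap_genB]))

/-- `heisFlip` preserves adjacency (an `a`-edge `g → g·a` becomes the `a`-edge `g·a⁻¹ ← g`). [cite: CheegerKleinerNaor2011, §1.1] -/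
theorem cayleyGraph_adj_heisFlip {g h : ℤ × ℤ × ℤ} (hgh : cayleyGraph.Adj g h) :
    cayleyGraph.Adj (heisFlip g) (heisFlip h) := by
  rw [cayleyGraph_adj_iff'] at hgh ⊢
  obtain ⟨hne, hrel⟩ := hgh
  refine ⟨fun heq => hne (by simpa using congrArg heisFlip heq), ?_⟩
  rcases hrel with (rfl | rfl) | (rfl | rfl)
  · refine Or.inr (Or.inl ?_)
    rw [heisFlip_heisMul, heisFlip_genA, heisMul_heisMul_heisInv_genA]
  · exact Or.inl (Or.inr (by rw [heisFlip_heisMul, heisFlip_genB]))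
  · refine Or.inl (Or.inl ?_)
    rw [heisFlip_heisMul, heisFlip_genA, heisMul_heisMul_heisInv_genA]
  · exact Or.inr (Or.inr (by rw [heisFlip_heisMul, heisFlip_genB]))

/-- **The swap `a ↔ b` as a graph automorphism of the Heisenberg Cayley graph fixing `1`.**
[cite: CheegerKleinerNaor2011, §1.1] -/
def heisSwapIso : cayleyGraph ≃g cayleyGraph where
  toFun := heisSwap
  invFun := heisSwap
  left_inv := heisSwap_heisSwap
  right_inv := heisSwap_heisSwap
  map_rel_iff' := by
    intro g h
    refine ⟨fun hgh => ?_, cayleyGraph_adj_heisSwap⟩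
    have := cayleyGraph_adj_heisSwap hgh
    simp only [Equiv.coe_fn_mk, heisSwap_heisSwap] at this
    exact this

/-- **The flip `a ↦ a⁻¹` as a graph automorphism of the Heisenberg Cayley graph fixing `1`.**
[cite: CheegerKleinerNaor2011, §1.1] -/
def heisFlipIso : cayleyGraph ≃g cayleyGraph where
  toFun := heisFlip
  invFun := heisFlip
  left_inv := heisFlip_heisFlip
  right_inv := heisFlip_heisFlip
  map_rel_iff' := by
    intro g h
    refine ⟨fun hgh => ?_, cayleyGraph_adj_heisFlip⟩
    have := cayleyGraph_adj_heisFlip hgh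
    simp only [Equiv.coe_fn_mk, heisFlip_heisFlip] at this
    exact this

/-- Both point symmetries fix the identity. [folklore] -/
theorem heisSwapIso_zero : heisSwapIso (0, 0, 0) = (0, 0, 0) ∧ heisFlipIso (0, 0, 0) = (0, 0, 0) := by
  constructor <;> rfl

/-! ### The abelianisation onto the square lattice `ℤ²` -/

/-- The abelianisation `(x,y,z) ↦ (x,y)` with values in the tree's `Site 2 = Fin 2 → ℤ`. [cite: CheegerKleinerNaor2011, §1.1] -/
def heisAb (g : ℤ × ℤ × ℤ) : Site 2 := ![g.1, g.2.1]

/-- First skeleton coordinate. [folklore] -/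
@[simp] theorem heisAb_apply_zero (g : ℤ × ℤ × ℤ) : heisAb g 0 = g.1 := rfl
/-- Second skeleton coordinate. [folklore] -/
@[simp] theorem heisAb_apply_one (g : ℤ × ℤ × ℤ) : heisAb g 1 = g.2.1 := rfl

/-- The abelianisation is a homomorphism: `φ(g·h) = φ(g) + φ(h)` — equivariance under the left
translations `heisLeftIso`. [cite: CheegerKleinerNaor2011, §1.1] -/
theorem heisAb_heisMul (g h : ℤ × ℤ × ℤ) : heisAb (heisMul g h) = heisAb g + heisAb h := by
  ext i
  fin_cases i <;> simp [heisAb, heisMul]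

/-- Equivariance under the swap: `φ ∘ σ` is the coordinate swap of `ℤ²`. [folklore] -/
theorem heisAb_heisSwap (g : ℤ × ℤ × ℤ) : heisAb (heisSwap g) = ![g.2.1, g.1] := by
  ext i
  fin_cases i <;> simp [heisAb, heisSwap]

/-- Equivariance under the flip: `φ ∘ τ` is the reflection `(x,y) ↦ (−x,y)` of `ℤ²`. [folklore] -/
theorem heisAb_heisFlip (g : ℤ × ℤ × ℤ) : heisAb (heisFlip g) = ![-g.1, g.2.1] := by
  ext i
  fin_cases i <;> simp [heisAb, heisFlip]

/-- **The abelianisation is a graph homomorphism onto the square lattice**: adjacent vertices of the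
Heisenberg Cayley graph have adjacent images in `zdGraph 2`. [cite: CheegerKleinerNaor2011, §1.1] -/
theorem zdGraph_adj_heisAb_of_adj {g h : ℤ × ℤ × ℤ} (hgh : cayleyGraph.Adj g h) :
    (zdGraph 2).Adj (heisAb g) (heisAb h) := by
  rw [cayleyGraph_adj_iff'] at hgh
  rw [zdGraph_adj_iff]
  obtain ⟨-, (rfl | rfl) | (rfl | rfl)⟩ := hgh
  · refine ⟨0, Or.inl ?_⟩
    rw [heisAb_heisMul]; ext i; fin_cases i <;> simp [heisAb, genA]
  · refine ⟨1, Or.inl ?_⟩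
    rw [heisAb_heisMul]; ext i; fin_cases i <;> simp [heisAb, genB]
  · refine ⟨0, Or.inr ?_⟩
    rw [heisAb_heisMul]; ext i; fin_cases i <;> simp [heisAb, genA]
  · refine ⟨1, Or.inr ?_⟩
    rw [heisAb_heisMul]; ext i; fin_cases i <;> simp [heisAb, genB]

/-- **Fibre control**: along an edge the central coordinate `z` moves by at most `|x|` (by `0` along an
`a`-edge, by `±x` along a `b`-edge) — so inside the cylinder `{|x|, |y| ≤ ℓ}` the `z`-levels of width `ℓ`
are cutsets (input Φ2). [cite: CheegerKleinerNaor2011, §1.1] -/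
theorem abs_sub_le_of_adj {g h : ℤ × ℤ × ℤ} (hgh : cayleyGraph.Adj g h) :
    |h.2.2 - g.2.2| ≤ max |g.1| |h.1| := by
  rw [cayleyGraph_adj] at hgh
  obtain ⟨-, (hr | hr) | (hr | hr)⟩ := hgh
  · rw [hr]
    simp
  · rw [hr]
    change |g.2.2 + g.1 - g.2.2| ≤ max |g.1| |g.1|
    rw [add_sub_cancel_left]
    exact le_max_left _ _
  · rw [hr]
    simp
  · rw [hr]
    change |h.2.2 - (h.2.2 + h.1)| ≤ max |h.1| |h.1|
    rw [show h.2.2 - (h.2.2 + h.1) = -h.1 by ring, abs_neg]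
    exact le_max_right _ _

end SameP

end Summit.CriticalPhenomena.PercolationContinuityZ3.Theorems

end
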